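import Literature.NumberTheory.Rogawski1990.UnitaryTwoTypeTwoEdgeCountAffine              -- ★ (P5f) B2″ p851884 (F0P3a-p09 (g9)): `natCard_fixedBy_iwahori_add_one_eq_two_mul_sum_of_affine`, `natCard_fixedBy_glInt_eq_sum_of_unitary_affine`
import Literature.NumberTheory.Automorphic.UnitaryOrbitalIntegralSimilitudeFixedPoints      -- ★ B-p10 (g25): `natCard_fixedBy_quotient_eq_natCard_fixedBy_quotient_cmDatumLocalNonsplitCongr_symm`; brings `coe_localNonsplitEquiv_cmDatumLocalNonsplitCongr_symm`
import Literature.NumberTheory.Automorphic.UnitaryUnitOrbitalIntegralLatticeCount             -- ★ `natCard_fixedBy_quotient_congr`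
import Literature.NumberTheory.Automorphic.UnitaryTwoEulerPoincareEllipticTypeTwo             -- ★ B-p08 (g28): the `|2|_w = 1` original (E) — for `formCongr_glDiagonal_one_eq_smul_placeForm_antidiag` and its import cone
import HarnessLib

/-!
# Kottwitz's type-(2) elliptic relation on `U(Φ₂)(L⁺_v)` WITH THE EISENSTEIN CENTRE (any residue characteristic):
# `#Fix(U₂⧸K, γ) + #Fix(U₂⧸K′, γ) = #Fix(U₂⧸I, γ) + 1`

Topic `NumberTheory/Automorphic`, namespace `Literature.NumberTheory.Automorphic.UnitaryGroup`.  THEOREMS ONLY: no definition, no named fact, no instance,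
no notation, no `sorry`; kernel lane `--kind proof --supports stmt-HodgeConjecture-24833`.  Cell `pub/hodgecm-mathlib`, crux H413 = `stmt-HodgeConjecture-24833`;
LH4 price list (4), dealer LH4-plan (g6∕g7) WORD #79 ∕ #5 (P5g) «(E) HYPOTHESIS-FORM RE-STATE», retiring MEMO «M6 ∕ EULER–POINCARÉ AT A WILD TYPE-(2) ROW» (B-p08 (g40),
sha16 544dfdf1cc8f9c98) §4 row «`Automorphic/UnitaryTwoEulerPoincareEllipticTypeTwo` (hyp. form) — RE-STATE»; this file F0P3b-p01 (g18).  HONEST LABEL: HC_CM is proved only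
modulo the cell's remaining named inputs (hLiu418 = stmt-HodgeConjecture-24832, h413 = stmt-HodgeConjecture-24833) until rung 0 closes; (R2) is a printed theorem
[Kottwitz1988 §2 Thm 2] and (D-UNR) stays PRINT — this file is count-neutral bookkeeping that asserts nothing printed.

THE TWIN.  ★ `Automorphic/UnitaryTwoEulerPoincareEllipticTypeTwo` (B-p08 (g28)) proves the (E)-clause `V_C(γ) + V_{C′}(γ) = E(γ) + 1` for a type-(2) elliptic `γ ∈ U₂ =
(cmDatum L 2 Φ₂).Local v` under `|2|_w = 1`, reading the centre `tr γ_w ∕ 2` and the radius `N` off `|tr² − 4det|_w = exp(−(2N+1))`.  Here the binder block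
`(h2v) (ht) (N) (hN)` is replaced by the EISENSTEIN PACKAGE of ★ (P5f) B2″ `Rogawski1990/UnitaryTwoTypeTwoEdgeCountAffine` (memo §2(e)∕§3, uniform over the rows (T), (W-odd),
(W-unit)): a centre `a ∈ 𝒪_w`, the AFFINE relation `(γ_w − a·1)² = f·(γ_w − a·1) + e′·1` with `|f| ≤ |ϖ_v^(j+1)|`, `|e′| = |ϖ_v^(2j+1)|` (radius `j`), `|σ_w(a)·a − 1| < 1`, and
the weak centring socket `|(γ_w)₁₀·σ_w a + σ_w((γ_w)₁₀)·a| ≤ |(γ_w)₁₀·ϖ_v^(j+1)|` (`γ_w = e_w γ` the one-place image, ★ `localNonsplitEquiv`).  The sentence is the SAME: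
**`#Fix(U₂ ⧸ C, γ) + #Fix(U₂ ⧸ C′, γ) = #Fix(U₂ ⧸ I, γ) + 1`** for subgroups `C, C′, I ≤ U₂` characterised at `w` by `GL₂(𝒪_w)`, `d·GL₂(𝒪_w)·d⁻¹` (`d = diag(1, ϖ)`, `ϖ` any
`σ_w`-fixed unit) and the Iwahori.  PROOF = the ★ proof (a)–(d) VERBATIM over the B2″ heads: (a) `E + 1 = 2Σ_(k≤j) q^k` (★ `natCard_fixedBy_iwahori_add_one_eq_two_mul_sum_of_affine`,
transported by ★ `natCard_fixedBy_quotient_congr`); (b) `V_C = Σ_(k≤j) q^k` (★ `natCard_fixedBy_glInt_eq_sum_of_unitary_affine`); (c) `V_{C′}(γ) = V_C(e_d⁻¹ γ)` (★ B-p10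
`…cmDatumLocalNonsplitCongr_symm`), and the Eisenstein package TRANSPORTS to `(e_d⁻¹ γ)_w = d⁻¹ γ_w d` (★ `coe_localNonsplitEquiv_cmDatumLocalNonsplitCongr_symm`): same
characteristic polynomial, the affine relation conjugates (`d⁻¹(γ_w − a·1)d`), and the socket rescales by the unit `|ϖ⁻¹|` because `(d⁻¹ γ_w d)₁₀ = ϖ⁻¹·(γ_w)₁₀` and
`σ_w ϖ = ϖ` — so (b) applies again; (d) `P + P = (2P − 1) + 1` (`omega`).  No parity flip for type (2), both vertex colours count alike, as in the original.

## References
* [Kottwitz1988] R. E. Kottwitz, *Tamagawa numbers*, Ann. of Math. 127 (1988), 629–646, §2 Theorem 2 (`O_γ(f_EP) = χ(X^γ) = 1` for elliptic `γ`).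
* [Rogawski1990] J. D. Rogawski, *Automorphic Representations of Unitary Groups in Three Variables* (1990), §3.6 p. 31 (the tori `(EK)¹`), §12.6 p. 174.
* [Serre1980Trees] J.-P. Serre, *Trees* (1980), Ch. II §1.1.
-/

set_option autoImplicit false

noncomputable section

open scoped ValuativeRel Matrix MatrixGroups
open Matrix ValuativeRel Finset NumberField IsDedekindDomain MulAction

namespace Literature.NumberTheory.Automorphic.UnitaryGroup

/-- `tr(T⁻¹ g T) = tr g` in `GL₂`. [cite: Kottwitz1988, §2] -/
private theorem trace_coe_conj_W {F : Type*} [Field F] (T g : GL (Fin 2) F) :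
    ((T⁻¹ * g * T : GL (Fin 2) F) : Matrix (Fin 2) (Fin 2) F).trace = (g : Matrix (Fin 2) (Fin 2) F).trace := by
  rw [Units.val_mul, Units.val_mul]; exact Matrix.trace_units_conj' _ _

/-- `det(T⁻¹ g T) = det g` in `GL₂`. [cite: Kottwitz1988, §2] -/
private theorem det_coe_conj_W {F : Type*} [Field F] (T g : GL (Fin 2) F) :
    ((T⁻¹ * g * T : GL (Fin 2) F) : Matrix (Fin 2) (Fin 2) F).det = (g : Matrix (Fin 2) (Fin 2) F).det := by
  rw [Units.val_mul, Units.val_mul]; exact Matrix.det_units_conj' _ _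

/-- **CONJUGATING AN AFFINE MATRIX RELATION**: if `(M − a·1)² = f·(M − a·1) + e′·1` then the same holds for `T⁻¹ M T` (`T ∈ GL₂`). [cite: Kottwitz1988, §2] -/
private theorem affine_rel_conj_W {F : Type*} [Field F] (T : GL (Fin 2) F) (M : Matrix (Fin 2) (Fin 2) F) (a f e' : F)
    (hk : (M - a • (1 : Matrix (Fin 2) (Fin 2) F)) * (M - a • (1 : Matrix (Fin 2) (Fin 2) F)) = f • (M - a • (1 : Matrix (Fin 2) (Fin 2) F)) + e' • (1 : Matrix (Fin 2) (Fin 2) F)) :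
    (((T⁻¹ : GL (Fin 2) F) : Matrix (Fin 2) (Fin 2) F) * M * (T : Matrix (Fin 2) (Fin 2) F) - a • (1 : Matrix (Fin 2) (Fin 2) F)) *
        (((T⁻¹ : GL (Fin 2) F) : Matrix (Fin 2) (Fin 2) F) * M * (T : Matrix (Fin 2) (Fin 2) F) - a • (1 : Matrix (Fin 2) (Fin 2) F)) =
      f • (((T⁻¹ : GL (Fin 2) F) : Matrix (Fin 2) (Fin 2) F) * M * (T : Matrix (Fin 2) (Fin 2) F) - a • (1 : Matrix (Fin 2) (Fin 2) F)) + e' • (1 : Matrix (Fin 2) (Fin 2) F) := by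
  have hTiTm : ((T⁻¹ : GL (Fin 2) F) : Matrix (Fin 2) (Fin 2) F) * (T : Matrix (Fin 2) (Fin 2) F) = 1 := by
    rw [← Units.val_mul, inv_mul_cancel, Units.val_one]
  have hTmTi : (T : Matrix (Fin 2) (Fin 2) F) * ((T⁻¹ : GL (Fin 2) F) : Matrix (Fin 2) (Fin 2) F) = 1 := by
    rw [← Units.val_mul, mul_inv_cancel, Units.val_one]
  have hsub : ((T⁻¹ : GL (Fin 2) F) : Matrix (Fin 2) (Fin 2) F) * M * (T : Matrix (Fin 2) (Fin 2) F) - a • (1 : Matrix (Fin 2) (Fin 2) F) =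
      ((T⁻¹ : GL (Fin 2) F) : Matrix (Fin 2) (Fin 2) F) * (M - a • (1 : Matrix (Fin 2) (Fin 2) F)) * (T : Matrix (Fin 2) (Fin 2) F) := by
    rw [Matrix.mul_sub, Matrix.sub_mul, Matrix.mul_smul, Matrix.mul_one, Matrix.smul_mul, hTiTm]
  rw [hsub]
  calc ((T⁻¹ : GL (Fin 2) F) : Matrix (Fin 2) (Fin 2) F) * (M - a • 1) * (T : Matrix (Fin 2) (Fin 2) F) *
          (((T⁻¹ : GL (Fin 2) F) : Matrix (Fin 2) (Fin 2) F) * (M - a • 1) * (T : Matrix (Fin 2) (Fin 2) F))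
        = ((T⁻¹ : GL (Fin 2) F) : Matrix (Fin 2) (Fin 2) F) * ((M - a • 1) * ((T : Matrix (Fin 2) (Fin 2) F) * ((T⁻¹ : GL (Fin 2) F) : Matrix (Fin 2) (Fin 2) F)) * (M - a • 1)) *
            (T : Matrix (Fin 2) (Fin 2) F) := by simp only [Matrix.mul_assoc]
    _ = ((T⁻¹ : GL (Fin 2) F) : Matrix (Fin 2) (Fin 2) F) * ((M - a • 1) * (M - a • 1)) * (T : Matrix (Fin 2) (Fin 2) F) := by rw [hTmTi, Matrix.mul_one]
    _ = ((T⁻¹ : GL (Fin 2) F) : Matrix (Fin 2) (Fin 2) F) * (f • (M - a • 1) + e' • 1) * (T : Matrix (Fin 2) (Fin 2) F) := by rw [hk]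
    _ = f • (((T⁻¹ : GL (Fin 2) F) : Matrix (Fin 2) (Fin 2) F) * (M - a • 1) * (T : Matrix (Fin 2) (Fin 2) F)) + e' • 1 := by
          rw [Matrix.mul_add, Matrix.add_mul, Matrix.mul_smul, Matrix.smul_mul, Matrix.mul_smul, Matrix.smul_mul, Matrix.mul_one, hTiTm]

/-- **THE `(1,0)` ENTRY UNDER `d = diag(1, ϖ)`**: `(d⁻¹ M d)₁₀ = ϖ⁻¹ · M₁₀`. [cite: Kottwitz1988, §2] -/
private theorem conj_glDiagonal_apply_one_zero_W {F : Type*} [Field F] (ϖ : Fˣ) (M : Matrix (Fin 2) (Fin 2) F) :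
    ((((glDiagonal 2 F ![1, ϖ])⁻¹ : GL (Fin 2) F) : Matrix (Fin 2) (Fin 2) F) * M * ((glDiagonal 2 F ![1, ϖ] : GL (Fin 2) F) : Matrix (Fin 2) (Fin 2) F)) 1 0 =
      ((ϖ⁻¹ : Fˣ) : F) * M 1 0 := by
  rw [← map_inv, coe_glDiagonal, coe_glDiagonal, Matrix.mul_apply, Fin.sum_univ_two, Matrix.mul_apply, Matrix.mul_apply, Fin.sum_univ_two, Fin.sum_univ_two]
  simp [Matrix.diagonal_apply_eq, Matrix.diagonal_apply_ne]

/-- **RESCALING THE WEAK CENTRING SOCKET BY A `σ`-FIXED SCALAR** (generic field, generic valuation: `g₁ = c·g`, `σ c = c` ⇒ the socket for `g` gives the socket for `g₁`). [cite: Kottwitz1988, §2] -/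
private theorem socket_rescale_W {K Γ₀ : Type*} [Field K] [LinearOrderedCommGroupWithZero Γ₀] (val : Valuation K Γ₀) (σ : K →+* K)
    (c g g₁ a P : K) (hg₁ : g₁ = c * g) (hσc : σ c = c) (h : val (g * σ a + σ g * a) ≤ val (g * P)) :
    val (g₁ * σ a + σ g₁ * a) ≤ val (g₁ * P) := by
  subst hg₁
  have e1 : c * g * σ a + σ (c * g) * a = c * (g * σ a + σ g * a) := by rw [map_mul, hσc]; ring
  rw [e1, mul_assoc, map_mul, map_mul]
  exact mul_le_mul_right h _

section CM

variable (L : Type) [Field L] [NumberField L] [IsCMField L] (v : HeightOneSpectrum (𝓞 ↥(maximalRealSubfield L)))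
  (w : PlacesOver L v) (hw : IsCMField.complexConj L • w.1 = w.1)

set_option maxHeartbeats 400000 in
include hw in
/-- **KOTTWITZ'S TYPE-(2) ELLIPTIC RELATION `V_C + V_{C′} = E + 1` ON `U₂`, EISENSTEIN CENTRE (any residue characteristic) — HYPOTHESIS FORM.**  At a finite place
`v` unramified and non-split in `L`, for subgroups `C, C′, I ≤ U₂` characterised at `w` by `GL₂(𝒪_w)`, `d GL₂(𝒪_w) d⁻¹` (`d = diag(1, ϖ)`, `ϖ` ANY `σ_w`-fixed unit of
`L_w`) and the Iwahori, and `γ ∈ U₂` whose one-place image `γ_w` has ROOTLESS characteristic polynomial and carries the Eisenstein package `(a, f, e′, j)` of ★ B2″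
(`a ∈ 𝒪_w`, `|f| ≤ |ϖ_v^(j+1)|`, `|e′| = |ϖ_v^(2j+1)|`, `(γ_w − a·1)² = f·(γ_w − a·1) + e′·1`, `|σ_w(a)·a − 1| < 1`, socket `|(γ_w)₁₀·σ_w a + σ_w((γ_w)₁₀)·a| ≤ |(γ_w)₁₀·ϖ_v^(j+1)|`):
`#Fix(U₂ ⧸ C, γ) + #Fix(U₂ ⧸ C′, γ) = #Fix(U₂ ⧸ I, γ) + 1` (`Σ + Σ = (2Σ − 1) + 1`, `Σ = Σ_(k≤j) q_v^k`).  Twin of ★ `natCard_fixedBy_add_eq_natCard_fixedBy_add_one_of_not_exists_isRoot`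
(`|2|_w = 1`, centre `tr∕2`, radius `N`); rows (T)∕(W-odd) read it at `a = tr γ_w ∕ 2`, `f = 0`, (W-unit) at the Eisenstein centre (memo §3).
[cite: Kottwitz1988, §2 Theorem 2] [cite: Rogawski1990, §12.6 p. 174] -/
theorem natCard_fixedBy_add_eq_natCard_fixedBy_add_one_of_affine (hunr : Algebra.IsUnramifiedIn (𝓞 L) v.asIdeal)
    (ϖ : (w.1.adicCompletion L)ˣ)
    (hσϖ : (galAdicCompletionMap (L := L) (IsCMField.complexConj L) hw) (ϖ : (w.1.adicCompletion L)) = ϖ)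
    (C C' I : Subgroup ((cmDatum L 2 (Matrix.of fun i j : Fin 2 => if i.val + j.val + 1 = 2 then (1 : L) else 0)).Local v))
    (hC : ∀ g, g ∈ C ↔ ((((localNonsplitEquiv (IsCMField.complexConj L) (Matrix.of fun i j : Fin 2 => if i.val + j.val + 1 = 2 then (1 : L) else 0) (IsCMField.complexConj_ne_one L) w hw) g : ↥(unitaryGroupOfForm (galAdicCompletionMap (L := L) (IsCMField.complexConj L) hw) (placeForm (Matrix.of fun i j : Fin 2 => if i.val + j.val + 1 = 2 then (1 : L) else 0) w.1))) : GL (Fin 2) (w.1.adicCompletion L))) ∈ glInt 2 (w.1.adicCompletion L))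
    (hC' : ∀ g, g ∈ C' ↔ ((((localNonsplitEquiv (IsCMField.complexConj L) (Matrix.of fun i j : Fin 2 => if i.val + j.val + 1 = 2 then (1 : L) else 0) (IsCMField.complexConj_ne_one L) w hw) g : ↥(unitaryGroupOfForm (galAdicCompletionMap (L := L) (IsCMField.complexConj L) hw) (placeForm (Matrix.of fun i j : Fin 2 => if i.val + j.val + 1 = 2 then (1 : L) else 0) w.1))) : GL (Fin 2) (w.1.adicCompletion L))) ∈ (glInt 2 (w.1.adicCompletion L)).map (MulAut.conj (glDiagonal 2 (w.1.adicCompletion L) ![1, ϖ])).toMonoidHom)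
    (hI : ∀ g, g ∈ I ↔ ((((localNonsplitEquiv (IsCMField.complexConj L) (Matrix.of fun i j : Fin 2 => if i.val + j.val + 1 = 2 then (1 : L) else 0) (IsCMField.complexConj_ne_one L) w hw) g : ↥(unitaryGroupOfForm (galAdicCompletionMap (L := L) (IsCMField.complexConj L) hw) (placeForm (Matrix.of fun i j : Fin 2 => if i.val + j.val + 1 = 2 then (1 : L) else 0) w.1))) : GL (Fin 2) (w.1.adicCompletion L))) ∈ iwahoriGL 2 (w.1.adicCompletion L))
    (γ : ((cmDatum L 2 (Matrix.of fun i j : Fin 2 => if i.val + j.val + 1 = 2 then (1 : L) else 0)).Local v))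
    (hirr : ¬ ∃ x : (w.1.adicCompletion L), (((((((localNonsplitEquiv (IsCMField.complexConj L) (Matrix.of fun i j : Fin 2 => if i.val + j.val + 1 = 2 then (1 : L) else 0) (IsCMField.complexConj_ne_one L) w hw) γ : ↥(unitaryGroupOfForm (galAdicCompletionMap (L := L) (IsCMField.complexConj L) hw) (placeForm (Matrix.of fun i j : Fin 2 => if i.val + j.val + 1 = 2 then (1 : L) else 0) w.1))) : GL (Fin 2) (w.1.adicCompletion L))) : Matrix (Fin 2) (Fin 2) (w.1.adicCompletion L))).charpoly).IsRoot x)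
    {a f e' : (w.1.adicCompletion L)} (ha : a ∈ 𝒪[(w.1.adicCompletion L)]) {j : ℕ}
    (hf : valuation (w.1.adicCompletion L) f ≤ valuation (w.1.adicCompletion L) (((toPlace v w (GaloisRepresentations.HeckeCharacter.uniformizer ↥(maximalRealSubfield L) v : v.adicCompletion ↥(maximalRealSubfield L)))) ^ (j + 1)))
    (hj : valuation (w.1.adicCompletion L) e' = valuation (w.1.adicCompletion L) (((toPlace v w (GaloisRepresentations.HeckeCharacter.uniformizer ↥(maximalRealSubfield L) v : v.adicCompletion ↥(maximalRealSubfield L)))) ^ (2 * j + 1)))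
    (hk : ((((((localNonsplitEquiv (IsCMField.complexConj L) (Matrix.of fun i j : Fin 2 => if i.val + j.val + 1 = 2 then (1 : L) else 0) (IsCMField.complexConj_ne_one L) w hw) γ : ↥(unitaryGroupOfForm (galAdicCompletionMap (L := L) (IsCMField.complexConj L) hw) (placeForm (Matrix.of fun i j : Fin 2 => if i.val + j.val + 1 = 2 then (1 : L) else 0) w.1))) : GL (Fin 2) (w.1.adicCompletion L))) : Matrix (Fin 2) (Fin 2) (w.1.adicCompletion L)) - a • (1 : Matrix (Fin 2) (Fin 2) (w.1.adicCompletion L))) * ((((((localNonsplitEquiv (IsCMField.complexConj L) (Matrix.of fun i j : Fin 2 => if i.val + j.val + 1 = 2 then (1 : L) else 0) (IsCMField.complexConj_ne_one L) w hw) γ : ↥(unitaryGroupOfForm (galAdicCompletionMap (L := L) (IsCMField.complexConj L) hw) (placeForm (Matrix.of fun i j : Fin 2 => if i.val + j.val + 1 = 2 then (1 : L) else 0) w.1))) : GL (Fin 2) (w.1.adicCompletion L))) : Matrix (Fin 2) (Fin 2) (w.1.adicCompletion L)) - a • (1 : Matrix (Fin 2) (Fin 2) (w.1.adicCompletion L)))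 = f • ((((((localNonsplitEquiv (IsCMField.complexConj L) (Matrix.of fun i j : Fin 2 => if i.val + j.val + 1 = 2 then (1 : L) else 0) (IsCMField.complexConj_ne_one L) w hw) γ : ↥(unitaryGroupOfForm (galAdicCompletionMap (L := L) (IsCMField.complexConj L) hw) (placeForm (Matrix.of fun i j : Fin 2 => if i.val + j.val + 1 = 2 then (1 : L) else 0) w.1))) : GL (Fin 2) (w.1.adicCompletion L))) : Matrix (Fin 2) (Fin 2) (w.1.adicCompletion L)) - a • (1 : Matrix (Fin 2) (Fin 2) (w.1.adicCompletion L))) + e' • (1 : Matrix (Fin 2) (Fin 2) (w.1.adicCompletion L)))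
    (haa : valuation (w.1.adicCompletion L) ((galAdicCompletionMap (L := L) (IsCMField.complexConj L) hw) a * a - 1) < 1)
    (hga' : valuation (w.1.adicCompletion L) ((((((localNonsplitEquiv (IsCMField.complexConj L) (Matrix.of fun i j : Fin 2 => if i.val + j.val + 1 = 2 then (1 : L) else 0) (IsCMField.complexConj_ne_one L) w hw) γ : ↥(unitaryGroupOfForm (galAdicCompletionMap (L := L) (IsCMField.complexConj L) hw) (placeForm (Matrix.of fun i j : Fin 2 => if i.val + j.val + 1 = 2 then (1 : L) else 0) w.1))) : GL (Fin 2) (w.1.adicCompletion L))) : Matrix (Fin 2) (Fin 2) (w.1.adicCompletion L)) 1 0 * (galAdicCompletionMap (L := L) (IsCMField.complexConj L) hw) a + (galAdicCompletionMap (L := L) (IsCMField.complexConj L) hw) ((((((localNonsplitEquiv (IsCMField.complexConj L) (Matrix.of fun i j : Fin 2 => if i.val + j.val + 1 = 2 then (1 : L) else 0) (IsCMField.complexConj_ne_one L) w hw) γ : ↥(unitaryGroupOfForm (galAdicCompletionMap (L := L) (IsCMField.complexConj L) hw) (placeForm (Matrix.of fun i j : Fin 2 => if i.val + j.val + 1 =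 2 then (1 : L) else 0) w.1))) : GL (Fin 2) (w.1.adicCompletion L))) : Matrix (Fin 2) (Fin 2) (w.1.adicCompletion L)) 1 0) * a) ≤ valuation (w.1.adicCompletion L) ((((((localNonsplitEquiv (IsCMField.complexConj L) (Matrix.of fun i j : Fin 2 => if i.val + j.val + 1 = 2 then (1 : L) else 0) (IsCMField.complexConj_ne_one L) w hw) γ : ↥(unitaryGroupOfForm (galAdicCompletionMap (L := L) (IsCMField.complexConj L) hw) (placeForm (Matrix.of fun i j : Fin 2 => if i.val + j.val + 1 = 2 then (1 : L) else 0) w.1))) : GL (Fin 2) (w.1.adicCompletion L))) : Matrix (Fin 2) (Fin 2) (w.1.adicCompletion L)) 1 0 * ((toPlace v w (GaloisRepresentations.HeckeCharacter.uniformizer ↥(maximalRealSubfield L) v : v.adicCompletion ↥(maximalRealSubfield L)))) ^ (j + 1))) :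
    Nat.card (fixedBy (((cmDatum L 2 (Matrix.of fun i j : Fin 2 => if i.val + j.val + 1 = 2 then (1 : L) else 0)).Local v) ⧸ C) γ) + Nat.card (fixedBy (((cmDatum L 2 (Matrix.of fun i j : Fin 2 => if i.val + j.val + 1 = 2 then (1 : L) else 0)).Local v) ⧸ C') γ) = Nat.card (fixedBy (((cmDatum L 2 (Matrix.of fun i j : Fin 2 => if i.val + j.val + 1 = 2 then (1 : L) else 0)).Local v) ⧸ I) γ) + 1 := by
  classical
  have hform := formCongr_glDiagonal_one_eq_smul_placeForm_antidiag L w hw ϖ hσϖ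
  -- (a) the edge count, transported to `U₂ ⧸ I`
  have hE : Nat.card (fixedBy (((cmDatum L 2 (Matrix.of fun i j : Fin 2 => if i.val + j.val + 1 = 2 then (1 : L) else 0)).Local v) ⧸ I) γ) = Nat.card (fixedBy (↥(unitaryGroupOfForm (galAdicCompletionMap (L := L) (IsCMField.complexConj L) hw) (placeForm (Matrix.of fun i j : Fin 2 => if i.val + j.val + 1 = 2 then (1 : L) else 0) w.1)) ⧸ ((iwahoriGL 2 (w.1.adicCompletion L)).subgroupOf (unitaryGroupOfForm (galAdicCompletionMap (L := L) (IsCMField.complexConj L) hw) (placeForm (Matrix.of fun i j : Fin 2 => if i.val + j.val + 1 = 2 then (1 : L) else 0) w.1)))) ((localNonsplitEquiv (IsCMField.complexConj L) (Matrix.of fun i j : Fin 2 => if i.val + j.val + 1 = 2 then (1 : L) else 0) (IsCMField.complexConj_ne_one L) w hw) γ)) :=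
    natCard_fixedBy_quotient_congr I _ (localNonsplitEquiv (IsCMField.complexConj L) (Matrix.of fun i j : Fin 2 => if i.val + j.val + 1 = 2 then (1 : L) else 0) (IsCMField.complexConj_ne_one L) w hw).toMulEquiv (fun g => (hI g).trans Subgroup.mem_subgroupOf.symm) γ
  have hEsum := natCard_fixedBy_iwahori_add_one_eq_two_mul_sum_of_affine L v w hw hunr ((localNonsplitEquiv (IsCMField.complexConj L) (Matrix.of fun i j : Fin 2 => if i.val + j.val + 1 = 2 then (1 : L) else 0) (IsCMField.complexConj_ne_one L) w hw) γ) hirr ha hf hj hk haa hga'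
  -- (b) the vertex count at `C`
  have hV : Nat.card (fixedBy (((cmDatum L 2 (Matrix.of fun i j : Fin 2 => if i.val + j.val + 1 = 2 then (1 : L) else 0)).Local v) ⧸ C) γ) = Nat.card (fixedBy (↥(unitaryGroupOfForm (galAdicCompletionMap (L := L) (IsCMField.complexConj L) hw) (placeForm (Matrix.of fun i j : Fin 2 => if i.val + j.val + 1 = 2 then (1 : L) else 0) w.1)) ⧸ ((glInt 2 (w.1.adicCompletion L)).subgroupOf (unitaryGroupOfForm (galAdicCompletionMap (L := L) (IsCMField.complexConj L) hw) (placeForm (Matrix.of fun i j : Fin 2 => if i.val + j.val + 1 = 2 then (1 : L) else 0) w.1)))) ((localNonsplitEquiv (IsCMField.complexConj L) (Matrix.of fun i j : Fin 2 => if i.val + j.val + 1 = 2 then (1 : L) else 0) (IsCMField.complexConj_ne_one L) w hw) γ)) :=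
    natCard_fixedBy_quotient_congr C _ (localNonsplitEquiv (IsCMField.complexConj L) (Matrix.of fun i j : Fin 2 => if i.val + j.val + 1 = 2 then (1 : L) else 0) (IsCMField.complexConj_ne_one L) w hw).toMulEquiv (fun g => (hC g).trans Subgroup.mem_subgroupOf.symm) γ
  have hVsum := natCard_fixedBy_glInt_eq_sum_of_unitary_affine L v w hw hunr ((localNonsplitEquiv (IsCMField.complexConj L) (Matrix.of fun i j : Fin 2 => if i.val + j.val + 1 = 2 then (1 : L) else 0) (IsCMField.complexConj_ne_one L) w hw) γ) hirr ha hf hj hk hga'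
  -- (c) the vertex count at `C′` = the count at `C` for `γ₁ = e_d⁻¹ γ`, whose one-place image is the conjugate `d⁻¹ γ_w d`
  have hV' := natCard_fixedBy_quotient_eq_natCard_fixedBy_quotient_cmDatumLocalNonsplitCongr_symm L 2 (Matrix.of fun i j : Fin 2 => if i.val + j.val + 1 = 2 then (1 : L) else 0) w hw (glDiagonal 2 (w.1.adicCompletion L) ![1, ϖ]) ϖ.isUnit hform
    (glInt 2 (w.1.adicCompletion L)) C C' hC hC' γ
  have hcoe₁ := coe_localNonsplitEquiv_cmDatumLocalNonsplitCongr_symm L 2 (Matrix.of fun i j : Fin 2 => if i.val + j.val + 1 = 2 then (1 : L) else 0) w hw (glDiagonal 2 (w.1.adicCompletion L) ![1, ϖ]) ϖ.isUnit hform γ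
  have hV₁ : Nat.card (fixedBy (((cmDatum L 2 (Matrix.of fun i j : Fin 2 => if i.val + j.val + 1 = 2 then (1 : L) else 0)).Local v) ⧸ C) ((cmDatumLocalNonsplitCongr L w hw (glDiagonal 2 (w.1.adicCompletion L) ![1, ϖ]) ϖ.isUnit hform).symm γ)) =
      Nat.card (fixedBy (↥(unitaryGroupOfForm (galAdicCompletionMap (L := L) (IsCMField.complexConj L) hw) (placeForm (Matrix.of fun i j : Fin 2 => if i.val + j.val + 1 = 2 then (1 : L) else 0) w.1)) ⧸ ((glInt 2 (w.1.adicCompletion L)).subgroupOf (unitaryGroupOfForm (galAdicCompletionMap (L := L) (IsCMField.complexConj L) hw) (placeForm (Matrix.of fun i j : Fin 2 => if i.val + j.val + 1 = 2 then (1 : L) else 0) w.1)))) ((localNonsplitEquiv (IsCMField.complexConj L) (Matrix.of fun i j : Fin 2 => if i.val + j.val + 1 = 2 then (1 : L) else 0) (IsCMField.complexConj_ne_one L) w hw) ((cmDatumLocalNonsplitCongr L w hw (glDiagonal 2 (w.1.adicCompletion L) ![1, ϖ]) ϖ.isUnit hform).symm γ))) :=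
    natCard_fixedBy_quotient_congr C _ (localNonsplitEquiv (IsCMField.complexConj L) (Matrix.of fun i j : Fin 2 => if i.val + j.val + 1 = 2 then (1 : L) else 0) (IsCMField.complexConj_ne_one L) w hw).toMulEquiv (fun g => (hC g).trans Subgroup.mem_subgroupOf.symm) ((cmDatumLocalNonsplitCongr L w hw (glDiagonal 2 (w.1.adicCompletion L) ![1, ϖ]) ϖ.isUnit hform).symm γ)
  -- (no `rw` in goals mentioning both `γ_w` and `(e_d⁻¹ γ)_w`: `kabstract` would compare the two and time out — term-mode `congrArg` + generic conjugation lemmas)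
  have hmat₁ : (((((localNonsplitEquiv (IsCMField.complexConj L) (Matrix.of fun i j : Fin 2 => if i.val + j.val + 1 = 2 then (1 : L) else 0) (IsCMField.complexConj_ne_one L) w hw) ((cmDatumLocalNonsplitCongr L w hw (glDiagonal 2 (w.1.adicCompletion L) ![1, ϖ]) ϖ.isUnit hform).symm γ) : ↥(unitaryGroupOfForm (galAdicCompletionMap (L := L) (IsCMField.complexConj L) hw) (placeForm (Matrix.of fun i j : Fin 2 => if i.val + j.val + 1 = 2 then (1 : L) else 0) w.1))) : GL (Fin 2) (w.1.adicCompletion L))) : Matrix (Fin 2) (Fin 2) (w.1.adicCompletion L)) =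
      ((((glDiagonal 2 (w.1.adicCompletion L) ![1, ϖ]))⁻¹ : GL (Fin 2) (w.1.adicCompletion L)) : Matrix (Fin 2) (Fin 2) (w.1.adicCompletion L)) * (((((localNonsplitEquiv (IsCMField.complexConj L) (Matrix.of fun i j : Fin 2 => if i.val + j.val + 1 = 2 then (1 : L) else 0) (IsCMField.complexConj_ne_one L) w hw) γ : ↥(unitaryGroupOfForm (galAdicCompletionMap (L := L) (IsCMField.complexConj L) hw) (placeForm (Matrix.of fun i j : Fin 2 => if i.val + j.val + 1 = 2 then (1 : L) else 0) w.1))) : GL (Fin 2) (w.1.adicCompletion L))) : Matrix (Fin 2) (Fin 2) (w.1.adicCompletion L)) * (((glDiagonal 2 (w.1.adicCompletion L) ![1, ϖ]) : GL (Fin 2) (w.1.adicCompletion L)) : Matrix (Fin 2) (Fin 2) (w.1.adicCompletion L)) :=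
    (congrArg (fun g : GL (Fin 2) (w.1.adicCompletion L) => (g : Matrix (Fin 2) (Fin 2) (w.1.adicCompletion L))) hcoe₁).trans (by rw [Units.val_mul, Units.val_mul])
  have htr₁ := (congrArg (fun g : GL (Fin 2) (w.1.adicCompletion L) => (g : Matrix (Fin 2) (Fin 2) (w.1.adicCompletion L)).trace) hcoe₁).trans (trace_coe_conj_W _ _)
  have hdet₁ := (congrArg (fun g : GL (Fin 2) (w.1.adicCompletion L) => (g : Matrix (Fin 2) (Fin 2) (w.1.adicCompletion L)).det) hcoe₁).trans (det_coe_conj_W _ _)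
  have hirr₁ : ¬ ∃ x : (w.1.adicCompletion L), (((((((localNonsplitEquiv (IsCMField.complexConj L) (Matrix.of fun i j : Fin 2 => if i.val + j.val + 1 = 2 then (1 : L) else 0) (IsCMField.complexConj_ne_one L) w hw) ((cmDatumLocalNonsplitCongr L w hw (glDiagonal 2 (w.1.adicCompletion L) ![1, ϖ]) ϖ.isUnit hform).symm γ) : ↥(unitaryGroupOfForm (galAdicCompletionMap (L := L) (IsCMField.complexConj L) hw) (placeForm (Matrix.of fun i j : Fin 2 => if i.val + j.val + 1 = 2 then (1 : L) else 0) w.1))) : GL (Fin 2) (w.1.adicCompletion L))) : Matrix (Fin 2) (Fin 2) (w.1.adicCompletion L))).charpoly).IsRoot x := by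
    rintro ⟨x, hx⟩
    rw [Matrix.charpoly_fin_two, htr₁, hdet₁] at hx
    exact hirr ⟨x, by rw [Matrix.charpoly_fin_two]; exact hx⟩
  have hk₁ : ((((((localNonsplitEquiv (IsCMField.complexConj L) (Matrix.of fun i j : Fin 2 => if i.val + j.val + 1 = 2 then (1 : L) else 0) (IsCMField.complexConj_ne_one L) w hw) ((cmDatumLocalNonsplitCongr L w hw (glDiagonal 2 (w.1.adicCompletion L) ![1, ϖ]) ϖ.isUnit hform).symm γ) : ↥(unitaryGroupOfForm (galAdicCompletionMap (L := L) (IsCMField.complexConj L) hw) (placeForm (Matrix.of fun i j : Fin 2 => if i.val + j.val + 1 = 2 then (1 : L) else 0) w.1))) : GL (Fin 2) (w.1.adicCompletion L))) : Matrix (Fin 2) (Fin 2) (w.1.adicCompletion L)) - a • (1 : Matrix (Fin 2) (Fin 2) (w.1.adicCompletion L))) * ((((((localNonsplitEquiv (IsCMField.complexConj L) (Matrix.of fun i j : Fin 2 => if i.val + j.val + 1 = 2 then (1 : L) else 0) (IsCMField.complexConj_ne_one L) w hw) ((cmDatumLocalNonsplitCongr L w hw (glDiagonal 2 (w.1.adicCompletion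 L) ![1, ϖ]) ϖ.isUnit hform).symm γ) : ↥(unitaryGroupOfForm (galAdicCompletionMap (L := L) (IsCMField.complexConj L) hw) (placeForm (Matrix.of fun i j : Fin 2 => if i.val + j.val + 1 = 2 then (1 : L) else 0) w.1))) : GL (Fin 2) (w.1.adicCompletion L))) : Matrix (Fin 2) (Fin 2) (w.1.adicCompletion L)) - a • (1 : Matrix (Fin 2) (Fin 2) (w.1.adicCompletion L))) = f • ((((((localNonsplitEquiv (IsCMField.complexConj L) (Matrix.of fun i j : Fin 2 => if i.val + j.val + 1 = 2 then (1 : L) else 0) (IsCMField.complexConj_ne_one L) w hw) ((cmDatumLocalNonsplitCongr L w hw (glDiagonal 2 (w.1.adicCompletion L) ![1, ϖ]) ϖ.isUnit hform).symm γ) : ↥(unitaryGroupOfForm (galAdicCompletionMap (L := L) (IsCMField.complexConj L) hw) (placeForm (Matrix.of fun i j : Fin 2 => if i.val + j.val + 1 = 2 then (1 : L) else 0) w.1))) : GL (Fin 2) (w.1.adicCompletion L))) : Matrix (Fin 2) (Fin 2) (w.1.adicCompletion L)) - a • (1 : Matrix (Fin 2) (Fin 2) (w.1.adicCompletion L)))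 + e' • (1 : Matrix (Fin 2) (Fin 2) (w.1.adicCompletion L)) := by
    rw [hmat₁]; exact affine_rel_conj_W _ _ a f e' hk
  -- `(e_d⁻¹ γ)_w₁₀ = ϖ⁻¹ · (γ_w)₁₀` (UNASCRIBED: an ascription juxtaposing `γ_w` and `(e_d⁻¹ γ)_w` sends `whnf` through `localNonsplitEquiv`)
  have h10 := (congrArg (fun M : Matrix (Fin 2) (Fin 2) (w.1.adicCompletion L) => M 1 0) hmat₁).trans (conj_glDiagonal_apply_one_zero_W ϖ _)
  have hσϖi : (galAdicCompletionMap (L := L) (IsCMField.complexConj L) hw) (((ϖ⁻¹ : (w.1.adicCompletion L)ˣ) : (w.1.adicCompletion L))) = ((ϖ⁻¹ : (w.1.adicCompletion L)ˣ) : (w.1.adicCompletion L)) := by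
    rw [Units.val_inv_eq_inv_val, map_inv₀, hσϖ]
  have hVsum₁ := natCard_fixedBy_glInt_eq_sum_of_unitary_affine L v w hw hunr ((localNonsplitEquiv (IsCMField.complexConj L) (Matrix.of fun i j : Fin 2 => if i.val + j.val + 1 = 2 then (1 : L) else 0) (IsCMField.complexConj_ne_one L) w hw) ((cmDatumLocalNonsplitCongr L w hw (glDiagonal 2 (w.1.adicCompletion L) ![1, ϖ]) ϖ.isUnit hform).symm γ)) hirr₁ ha hf hj hk₁
    (socket_rescale_W (valuation (w.1.adicCompletion L)) (galAdicCompletionMap (L := L) (IsCMField.complexConj L) hw) _ _ _ a _ h10 hσϖi hga')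
  -- (d) assemble: `Σ + Σ = (2Σ − 1) + 1` (term-mode collection, `omega`)
  omega

end CM

end Literature.NumberTheory.Automorphic.UnitaryGroup

end
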